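import Literature.Computability.AlgebraicComplexity.BorderApolarityTriples
import Literature.Computability.AlgebraicComplexity.MatrixMultiplicationExponent
import Literature.Computability.AlgebraicComplexity.BorderRankMatMulThreeSigma
import HarnessLib

/-!
# Border apolarity for `M⟨3⟩` at `r = 17`: the degree-`≤ 3` tests are passed (a method ceiling)

Topic `Literature/Computability/AlgebraicComplexity`. Conner–Harper–Landsberg 2023 prove
`R̲(M⟨3⟩) ≥ 17` by Borel-fixed border apolarity: every candidate triple for `r = 16` fails one of
the `(210)`, `(120)`, `(111)` tests (the tree: `seventeen_le_algBorderRank_matMulTensor_three`,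
`BorderRankMatMulThreeSeventeen.lean`, refuting `IsCandidateTriple 16 (matMulTensor K 3 3 3)`).
In the journal version they add (Remark 1.8, verbatim): "After this paper was posted on arXiv, we
went on to find an ideal passing all border apolarity tests for `M⟨3⟩` with `r = 17`. We are
currently working to effectively implement deformation theory to determine if such an example
comes from an actual border rank 17 decomposition." (also Landsberg, Differential Geom. Appl. 82
(2022) §9.4: "we are able to construct candidate ideals for border rank 17").

This file makes the degree-`≤ 3`, span-side part of that remark a kernel-checked theorem, over
EVERY field: explicit subspaces `E₁ ⊆ A ⊗ B`, `E₂ ⊆ B ⊗ C`, `E₃ ⊆ A ⊗ C` of dimension `17`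
containing the slices of `M⟨3⟩` and passing the six `(210)`-type tests and the `(111)` test of
`IsCandidateTriple 17` (`BorderApolarityTriples.lean`; over `ℚ` the seven test spaces have
dimensions `18, 20, 18, 18, 19, 24` and `17`):

* `BorderApolarity.MatMul3.R17.exists_isCandidateTriple_seventeen` /
  `exists_isCandidateTriple_seventeen_matMulTensor_three` —
  **`∃ E₁ E₂ E₃, IsCandidateTriple 17 (matMulTensor K 3 3 3) E₁ E₂ E₃` for every field `K`;**
* `BorderApolarity.MatMul3.IsAdmissibleAt r E` — the closure properties of `MatMul3.IsAdmissible`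
  (`BorderRankMatMulThreeBlocks.lean`) with budget `dim E ≤ r` (`isAdmissibleAt_sixteen_iff`);
* `BorderApolarity.MatMul3.R17.exists_admissibleAt_candidateTriple_seventeen` — **the witness is
  moreover ADMISSIBLE at budget `17`** (`E₁`, `E₂ ∘ σ₂`, `E₃ ∘ σ₃` contain the root-coordinate and
  block-diagonal components of their elements and the block identities and are stable under
  `ad X_{pq}` and the block shifts, `p < q`), i.e. it has exactly the shape produced by the
  Borel-fixed normal form `exists_admissible_triple` (`BorderRankMatMulThreeTransport.lean`) of the
  `r = 16` refutation, with `17` for `16`: that enumeration, rerun at `r = 17`, is not empty.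

Since `IsCandidateTriple r t` is exactly the necessary condition for `R̲(t) ≤ r` that elementary
border apolarity extracts in tri-degrees of total degree `≤ 3`
(`exists_candidateTriple_of_isApproxDecomposition`, `BorderApolarityTriplesPert.lean`), this is a
CEILING statement for those tests: they certify `17` for `M⟨3⟩` (with the Borel-fixed reduction,
`BorderRankMatMulThreeSeventeen.lean`) and are satisfiable at `r = 17`; going further needs higher
multidegrees or the deformation-theoretic step of CHL §1.3.1 / Rem. 1.8. Nothing here is a new
bound: `17 ≤ R̲(M⟨3⟩) ≤ 20` stands.

The witness. Each of the three spaces is `M⟨3⟩(C*)` (the nine block identities of the block model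
of `BorderRankMatMulThreeBlocks.lean`) plus eight root unit vectors; it was found by re-running the
Borel-fixed enumeration of the tree's `r = 16` refutation (`BorderRankMatMulThreeKernel.lean`
encoding) at `r = 17`, where candidates survive; its admissibility (the tree's intrinsic form of
"graded and Borel fixed") is re-checked here by the kernel on the rows (`R17.admCheck`: images under
the coordinate components, `diagProj`, `adU`, `shiftV`, `shiftW` lie in the span), the relabelings
`σ₂`, `σ₃` of `BorderRankMatMulThreeSigma.lean` being applied to the data (`R17.relabelCheck`).
All data are `0/1` weight vectors.
Verification is by the kernel on sparse integer vectors (`R17.coef`; codes `9a + b` for pairs and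
`81a + 9b + c` for triples, `a = 3i + k`, `b = 3i' + j`, `c = 3j' + k'` for
`t (i,k) (i',j) (j',k') = [i = i'][j = j'][k = k']`): membership in a span is an integer identity
against an echelon basis with unit pivots (`R17.memCheck`), independence is a unit pivot pattern
(`R17.pivCheck` with `linearIndependent_of_triangular`), symmetry and the slices of `M⟨3⟩` are
checked coordinatewise, and the soundness lemmas transport these integer facts to any field along
`Int.cast`.

Deliberately NOT here: tests of multidegree `≥ 4` (CHL's ideal passes those too, Rem. 1.8; not
formalised), and anything about actual border rank `17` decompositions of `M⟨3⟩` (open).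

## References

* A. Conner, A. Harper, J. M. Landsberg, *New lower bounds for matrix multiplication and `det₃`*,
  Forum Math. Pi 11 (2023) e17, arXiv:1911.07981 — Rem. 1.8, §1.3.1, §3, §6. [ConnerHarperLandsberg2023]
* J. M. Landsberg, *Algebraic geometry and representation theory in the study of matrix
  multiplication complexity and other problems in theoretical computer science*, Differential
  Geom. Appl. 82 (2022) 101888, arXiv:2108.06263 — §9.4. [Landsberg2022SecantSurvey]
-/

namespace Literature.Computability.AlgebraicComplexity

namespace BorderApolarity

namespace MatMul3

universe u

namespace R17

/-! ## Sparse integer vectors (computation) -/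

/-- Coefficient of the code `c` in a sparse integer vector (the sum of the values of the entries
with that code). [folklore] -/
def coef : List (ℕ × ℤ) → ℕ → ℤ
  | [], _ => 0
  | e :: v, c => (if e.1 = c then e.2 else 0) + coef v c

/-- Scaling of a sparse vector. [folklore] -/
def scale (a : ℤ) (v : List (ℕ × ℤ)) : List (ℕ × ℤ) := v.map fun e => (e.1, a * e.2)

/-- The linear combination `∑_{i ∈ L} cs i • B[i]` of rows of `B` (zero coefficients skipped). [folklore] -/
def lin (cs : ℕ → ℤ) (B : List (List (ℕ × ℤ))) : List ℕ → List (ℕ × ℤ)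
  | [] => []
  | i :: L => (if cs i = 0 then [] else scale (cs i) (B.getD i [])) ++ lin cs B L

/-- The residual `s - ∑_{i<17} s(piv_i) • B[i]` of `s` against an echelon basis `B` with unit
pivots `piv`. [folklore] -/
def residual (B : List (List (ℕ × ℤ))) (piv : List ℕ) (s : List (ℕ × ℤ)) : List (ℕ × ℤ) :=
  s ++ lin (fun i => -coef s (piv.getD i 0)) B (List.range 17)

/-- Membership check: the residual vanishes on its own support (hence everywhere). [folklore] -/
def memCheck (B : List (List (ℕ × ℤ))) (piv : List ℕ) (s : List (ℕ × ℤ)) : Bool :=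
  (residual B piv s).all fun e => coef (residual B piv s) e.1 == 0

/-- The `x₀`-slice `(x₁, s) ↦ w(x₀, x₁, s)` of a sparse triple vector: entries with code
`81 x₀ + m` become `m`. [folklore] -/
def sliceIList (x0 : ℕ) : List (ℕ × ℤ) → List (ℕ × ℤ)
  | [] => []
  | e :: w => if e.1 / 81 = x0 then (e.1 % 81, e.2) :: sliceIList x0 w else sliceIList x0 w

/-- The `s₁`-slice `(x, s₀) ↦ w(x, s₀, s₁)` of a sparse triple vector: entries with code
`9 m + s₁` become `m`. [folklore] -/
def sliceKList (s1 : ℕ) : List (ℕ × ℤ) → List (ℕ × ℤ)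
  | [] => []
  | e :: w => if e.1 % 9 = s1 then (e.1 / 9, e.2) :: sliceKList s1 w else sliceKList s1 w

/-- The middle slice `(a, c) ↦ w(a, b, c)` of a sparse triple vector: entries with code
`81 a + 9 b + c` become `9 a + c`. [folklore] -/
def sliceBList (b : ℕ) : List (ℕ × ℤ) → List (ℕ × ℤ)
  | [] => []
  | e :: w => if e.1 / 9 % 9 = b then (9 * (e.1 / 81) + e.1 % 9, e.2) :: sliceBList b w
      else sliceBList b w

/-- Unit pivot pattern of `17` triple vectors: `W[j](qs_j) = 1`, `W[k](qs_j) = 0` for `k ≠ j`,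
`qs_j < 729`. [folklore] -/
def pivCheck (W : List (List (ℕ × ℤ))) (qs : List ℕ) : Bool :=
  (List.range 17).all fun j =>
    decide (qs.getD j 0 < 729) && (coef (W.getD j []) (qs.getD j 0) == 1) &&
      (List.range 17).all fun k => (j == k) || (coef (W.getD k []) (qs.getD j 0) == 0)

/-- The transposition `(x₀, x₁, s) ↦ (x₁, x₀, s)` on triple codes. [folklore] -/
def swapI (c : ℕ) : ℕ := 81 * (c / 9 % 9) + 9 * (c / 81) + c % 9

/-- The transposition `(x, s₀, s₁) ↦ (x, s₁, s₀)` on triple codes. [folklore] -/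
def swapK (c : ℕ) : ℕ := 81 * (c / 81) + 9 * (c % 9) + c / 9 % 9

/-- The `(210)`-type test check of a witness family `W` against the candidate basis `(B, piv)`:
pivots, symmetry in the first two slots, and all nine first-slot slices in the span. [folklore] -/
def testICheck (B : List (List (ℕ × ℤ))) (piv : List ℕ) (W : List (List (ℕ × ℤ)))
    (qs : List ℕ) : Bool :=
  pivCheck W qs && (List.range 17).all fun j =>
    ((List.range 729).all fun c => coef (W.getD j []) c == coef (W.getD j []) (swapI c)) &&
      (List.range 9).all fun x0 => memCheck B piv (sliceIList x0 (W.getD j []))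

/-- The `(120)`-type test check: pivots, symmetry in the last two slots, and all nine last-slot
slices in the span. [folklore] -/
def testKCheck (B : List (List (ℕ × ℤ))) (piv : List ℕ) (W : List (List (ℕ × ℤ)))
    (qs : List ℕ) : Bool :=
  pivCheck W qs && (List.range 17).all fun j =>
    ((List.range 729).all fun c => coef (W.getD j []) c == coef (W.getD j []) (swapK c)) &&
      (List.range 9).all fun s1 => memCheck B piv (sliceKList s1 (W.getD j []))

/-- The `(111)`-test check: pivots, and the three families of slices in `E₁`, `E₂`, `E₃`. [folklore] -/
def tripleCheck (B1 : List (List (ℕ × ℤ))) (piv1 : List ℕ) (B2 : List (List (ℕ × ℤ)))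
    (piv2 : List ℕ) (B3 : List (List (ℕ × ℤ))) (piv3 : List ℕ) (W : List (List (ℕ × ℤ)))
    (qs : List ℕ) : Bool :=
  pivCheck W qs && (List.range 17).all fun j =>
    ((List.range 9).all fun c => memCheck B1 piv1 (sliceKList c (W.getD j []))) &&
    ((List.range 9).all fun a => memCheck B2 piv2 (sliceIList a (W.getD j []))) &&
    ((List.range 9).all fun b => memCheck B3 piv3 (sliceBList b (W.getD j [])))

/-- `M⟨3⟩` on slot codes: `t(a, b, c) = [a/3 = b/3][b%3 = c/3][a%3 = c%3]`. [folklore] -/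
def tZ (a b c : ℕ) : ℤ := if a / 3 = b / 3 ∧ b % 3 = c / 3 ∧ a % 3 = c % 3 then 1 else 0

/-- `M⟨3⟩` with the free slot `k ∈ {1,2,3}` set to `n` and the pair code `m` in the other two:
`k = 1`: `t(m/9, m%9, n)`; `k = 2`: `t(n, m/9, m%9)`; `k = 3`: `t(m/9, n, m%9)`. [folklore] -/
def tZk (k n m : ℕ) : ℤ :=
  if k = 1 then tZ (m / 9) (m % 9) n else if k = 2 then tZ n (m / 9) (m % 9) else tZ (m / 9) n (m % 9)

/-- The slice of `M⟨3⟩` for slot `k` at `n`, as a sparse pair vector. [folklore] -/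
def tslice (k n : ℕ) : List (ℕ × ℤ) :=
  ((List.range 81).filter fun m => tZk k n m == 1).map fun m => (m, 1)

/-- Check that the nine slices for slot `k` are the listed sparse vectors and lie in the span of
`(B, piv)`. [folklore] -/
def sliceCheck (k : ℕ) (B : List (List (ℕ × ℤ))) (piv : List ℕ) : Bool :=
  (List.range 9).all fun n =>
    ((List.range 81).all fun m => coef (tslice k n) m == tZk k n m) && memCheck B piv (tslice k n)

/-! ## The witness data (sparse integer vectors `(code, value)`) -/

/-- Echelon basis of the candidate `E₁ ⊆ A ⊗ B` (pair codes `9a + b`): the Borel-fixed model of profile #11 of the `r = 17` census, `17` weight vectors. [folklore] -/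
def B1 : List (List (ℕ × ℤ)) := [
  [(0, 1), (30, 1), (60, 1)], [(1, 1), (31, 1), (61, 1)], [(2, 1), (32, 1), (62, 1)], [(3, 1)],
  [(4, 1)], [(6, 1)], [(7, 1)], [(9, 1), (39, 1), (69, 1)],
  [(10, 1), (40, 1), (70, 1)], [(11, 1), (41, 1), (71, 1)], [(12, 1)], [(13, 1)],
  [(15, 1)], [(16, 1)], [(18, 1), (48, 1), (78, 1)], [(19, 1), (49, 1), (79, 1)],
  [(20, 1), (50, 1), (80, 1)]]

/-- Pivot codes of `B1` (each vector is `1` at its pivot, the others vanish there). [folklore] -/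
def B1piv : List ℕ := [0, 1, 2, 3, 4, 6, 7, 9, 10, 11, 12, 13, 15, 16, 18, 19, 20]

/-- Echelon basis of the candidate `E₂ ⊆ B ⊗ C` (pair codes `9b + c`): the Borel-fixed model of profile #182 of the `r = 17` census, `17` weight vectors. [folklore] -/
def B2 : List (List (ℕ × ℤ)) := [
  [(0, 1), (12, 1), (24, 1)], [(1, 1), (13, 1), (25, 1)], [(2, 1), (14, 1), (26, 1)], [(27, 1), (39, 1), (51, 1)],
  [(28, 1), (40, 1), (52, 1)], [(29, 1), (41, 1), (53, 1)], [(32, 1)], [(34, 1)],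
  [(35, 1)], [(54, 1), (66, 1), (78, 1)], [(55, 1), (67, 1), (79, 1)], [(56, 1), (68, 1), (80, 1)],
  [(59, 1)], [(61, 1)], [(62, 1)], [(70, 1)],
  [(71, 1)]]

/-- Pivot codes of `B2` (each vector is `1` at its pivot, the others vanish there). [folklore] -/
def B2piv : List ℕ := [0, 1, 2, 27, 28, 29, 32, 34, 35, 54, 55, 56, 59, 61, 62, 70, 71]

/-- Echelon basis of the candidate `E₃ ⊆ A ⊗ C` (pair codes `9a + c`): the Borel-fixed model of profile #148 of the `r = 17` census, `17` weight vectors. [folklore] -/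
def B3 : List (List (ℕ × ℤ)) := [
  [(0, 1), (10, 1), (20, 1)], [(3, 1), (13, 1), (23, 1)], [(5, 1)], [(6, 1)],
  [(7, 1)], [(8, 1)], [(14, 1)], [(15, 1)],
  [(16, 1)], [(17, 1)], [(26, 1)], [(27, 1), (37, 1), (47, 1)],
  [(30, 1), (40, 1), (50, 1)], [(33, 1), (43, 1), (53, 1)], [(54, 1), (64, 1), (74, 1)], [(57, 1), (67, 1), (77, 1)],
  [(60, 1), (70, 1), (80, 1)]]

/-- Pivot codes of `B3` (each vector is `1` at its pivot, the others vanish there). [folklore] -/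
def B3piv : List ℕ := [0, 3, 5, 6, 7, 8, 14, 15, 16, 17, 26, 27, 30, 33, 54, 57, 60]

/-- `(210)`-test witnesses for `E₁`: `17` independent triple vectors (codes `81x + 9y + z`), of the `18` available. [folklore] -/
def WI1 : List (List (ℕ × ℤ)) := [
  [(3, 1)], [(4, 1)], [(6, 1)],
  [(7, 1)], [(12, 1), (84, 1)], [(13, 1), (85, 1)],
  [(15, 1), (87, 1)], [(16, 1), (88, 1)], [(93, 1)],
  [(94, 1)], [(96, 1)], [(97, 1)],
  [(0, 1), (30, 1), (60, 1), (246, 1), (492, 1)], [(1, 1), (31, 1), (61, 1), (247, 1), (493, 1)], [(9, 1), (39, 1), (69, 1), (81, 1), (111, 1), (141, 1), (255, 1), (327, 1), (501, 1), (573, 1)],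
  [(90, 1), (120, 1), (150, 1), (336, 1), (582, 1)], [(91, 1), (121, 1), (151, 1), (337, 1), (583, 1)]]

/-- Pivot codes of `WI1` (each vector is `1` at its pivot, the others vanish there). [folklore] -/
def WI1piv : List ℕ := [3, 4, 6, 7, 84, 85, 87, 88, 93, 94, 96, 97, 492, 493, 573, 582, 583]

/-- `(120)`-test witnesses for `E₁`: `17` independent triple vectors (codes `81x + 9y + z`), of the `20` available. [folklore] -/
def WK1 : List (List (ℕ × ℤ)) := [
  [(30, 1)], [(31, 1), (39, 1)], [(40, 1)],
  [(33, 1), (57, 1)], [(42, 1), (58, 1)], [(60, 1)],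
  [(34, 1), (66, 1)], [(43, 1), (67, 1)], [(61, 1), (69, 1)],
  [(70, 1)], [(111, 1)], [(112, 1), (120, 1)],
  [(121, 1)], [(114, 1), (138, 1)], [(123, 1), (139, 1)],
  [(141, 1)], [(151, 1)]]

/-- Pivot codes of `WK1` (each vector is `1` at its pivot, the others vanish there). [folklore] -/
def WK1piv : List ℕ := [30, 39, 40, 57, 58, 60, 66, 67, 69, 70, 111, 120, 121, 138, 139, 141, 151]

/-- `(021)`-test witnesses for `E₂`: `17` independent triple vectors (codes `81x + 9y + z`), of the `18` available. [folklore] -/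
def WI2 : List (List (ℕ × ℤ)) := [
  [(275, 1)], [(277, 1)], [(278, 1)],
  [(272, 1), (284, 1), (296, 1), (356, 1), (440, 1)], [(302, 1), (518, 1)], [(304, 1), (520, 1)],
  [(305, 1), (521, 1)], [(545, 1)], [(547, 1)],
  [(548, 1)], [(313, 1), (601, 1)], [(314, 1), (602, 1)],
  [(556, 1), (628, 1)], [(557, 1), (629, 1)], [(637, 1)],
  [(638, 1)], [(542, 1), (554, 1), (566, 1), (626, 1), (710, 1)]]

/-- Pivot codes of `WI2` (each vector is `1` at its pivot, the others vanish there). [folklore] -/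
def WI2piv : List ℕ := [275, 277, 278, 440, 518, 520, 521, 545, 547, 548, 601, 602, 628, 629, 637, 638, 710]

/-- `(012)`-test witnesses for `E₂`: `17` independent triple vectors (codes `81x + 9y + z`), of the `18` available. [folklore] -/
def WK2 : List (List (ℕ × ℤ)) := [
  [(293, 1)], [(295, 1), (311, 1)], [(313, 1)],
  [(296, 1), (320, 1)], [(314, 1), (322, 1)], [(323, 1)],
  [(536, 1)], [(538, 1), (554, 1)], [(556, 1)],
  [(539, 1), (563, 1)], [(557, 1), (565, 1)], [(566, 1)],
  [(637, 1)], [(638, 1), (646, 1)], [(647, 1)],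
  [(502, 1), (550, 1), (610, 1), (634, 1), (718, 1)], [(512, 1), (560, 1), (620, 1), (644, 1), (728, 1)]]

/-- Pivot codes of `WK2` (each vector is `1` at its pivot, the others vanish there). [folklore] -/
def WK2piv : List ℕ := [293, 311, 313, 320, 322, 323, 536, 554, 556, 563, 565, 566, 637, 646, 647, 718, 728]

/-- `(201)`-test witnesses for `E₃`: `17` independent triple vectors (codes `81x + 9y + z`), of the `19` available. [folklore] -/
def WI3 : List (List (ℕ × ℤ)) := [
  [(5, 1)], [(6, 1)], [(7, 1)],
  [(8, 1)], [(14, 1), (86, 1)], [(15, 1), (87, 1)],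
  [(16, 1), (88, 1)], [(17, 1), (89, 1)], [(95, 1)],
  [(96, 1)], [(97, 1)], [(98, 1)],
  [(26, 1), (170, 1)], [(107, 1), (179, 1)], [(188, 1)],
  [(33, 1), (43, 1), (53, 1), (249, 1), (331, 1), (413, 1)], [(114, 1), (124, 1), (134, 1), (258, 1), (340, 1), (422, 1)]]

/-- Pivot codes of `WI3` (each vector is `1` at its pivot, the others vanish there). [folklore] -/
def WI3piv : List ℕ := [5, 6, 7, 8, 86, 87, 88, 89, 95, 96, 97, 98, 170, 179, 188, 413, 422]

/-- `(102)`-test witnesses for `E₃`: `17` independent triple vectors (codes `81x + 9y + z`), of the `24` available. [folklore] -/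
def WK3 : List (List (ℕ × ℤ)) := [
  [(50, 1)], [(51, 1), (59, 1)], [(60, 1)],
  [(52, 1), (68, 1)], [(61, 1), (69, 1)], [(70, 1)],
  [(53, 1), (77, 1)], [(62, 1), (78, 1)], [(71, 1), (79, 1)],
  [(80, 1)], [(131, 1)], [(132, 1), (140, 1)],
  [(141, 1)], [(133, 1), (149, 1)], [(151, 1)],
  [(161, 1)], [(242, 1)]]

/-- Pivot codes of `WK3` (each vector is `1` at its pivot, the others vanish there). [folklore] -/
def WK3piv : List ℕ := [50, 59, 60, 68, 69, 70, 77, 78, 79, 80, 131, 140, 141, 149, 151, 161, 242]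

/-- `(111)`-test witnesses (sixteen coordinate vectors and `M⟨3⟩` itself): `17` independent triple vectors (codes `81x + 9y + z`), of the `17` available. [folklore] -/
def WT : List (List (ℕ × ℤ)) := [
  [(32, 1)], [(34, 1)], [(35, 1)],
  [(59, 1)], [(61, 1)], [(62, 1)],
  [(70, 1)], [(71, 1)], [(113, 1)],
  [(115, 1)], [(116, 1)], [(140, 1)],
  [(142, 1)], [(143, 1)], [(151, 1)],
  [(152, 1)], [(0, 1), (12, 1), (24, 1), (82, 1), (94, 1), (106, 1), (164, 1), (176, 1), (188, 1), (270, 1), (282, 1), (294, 1), (352, 1), (364, 1), (376, 1), (434, 1), (446, 1), (458, 1), (540, 1), (552, 1), (564, 1), (622, 1), (634, 1), (646, 1), (704, 1), (716, 1), (728, 1)]]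

/-- Pivot codes of `WT` (each vector is `1` at its pivot, the others vanish there). [folklore] -/
def WTpiv : List ℕ := [32, 34, 35, 59, 61, 62, 70, 71, 113, 115, 116, 140, 142, 143, 151, 152, 728]

/-! ## Codes of the index types -/

/-- The slot index type `Fin 3 × Fin 3` of `⟨3,3,3⟩`. [folklore] -/
abbrev Idx : Type := Fin 3 × Fin 3

/-- Slot code `3i + k` of `(i, k)`. [folklore] -/
def c9 (x : Idx) : ℕ := 3 * (x.1 : ℕ) + (x.2 : ℕ)

/-- `c9 < 9`. [folklore] -/
private theorem c9_lt (x : Idx) : c9 x < 9 := by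
  have := x.1.isLt; have := x.2.isLt; unfold c9; omega

/-- `c9 / 3` is the first component. [folklore] -/
private theorem c9_div (x : Idx) : c9 x / 3 = (x.1 : ℕ) := by
  have := x.2.isLt; unfold c9; omega

/-- `c9 % 3` is the second component. [folklore] -/
private theorem c9_mod (x : Idx) : c9 x % 3 = (x.2 : ℕ) := by
  have := x.2.isLt; unfold c9; omega

/-- Pair code `9a + b`. [folklore] -/
def pcode (p : Idx × Idx) : ℕ := 9 * c9 p.1 + c9 p.2

/-- `pcode < 81`. [folklore] -/
private theorem pcode_lt (p : Idx × Idx) : pcode p < 81 := by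
  have := c9_lt p.1; have := c9_lt p.2; unfold pcode; omega

/-- `pcode / 9` is the first code. [folklore] -/
private theorem pcode_div (p : Idx × Idx) : pcode p / 9 = c9 p.1 := by
  have := c9_lt p.2; unfold pcode; omega

/-- `pcode % 9` is the second code. [folklore] -/
private theorem pcode_mod (p : Idx × Idx) : pcode p % 9 = c9 p.2 := by
  have := c9_lt p.2; unfold pcode; omega

/-- Triple code `81a + 9b + c`. [folklore] -/
def tcode (p : Idx × Idx × Idx) : ℕ := 81 * c9 p.1 + 9 * c9 p.2.1 + c9 p.2.2

/-- `tcode < 729`. [folklore] -/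
private theorem tcode_lt (p : Idx × Idx × Idx) : tcode p < 729 := by
  have := c9_lt p.1; have := c9_lt p.2.1; have := c9_lt p.2.2; unfold tcode; omega

/-- Decoding of a slot code. [folklore] -/
def d9 (n : ℕ) : Idx := (⟨n / 3 % 3, Nat.mod_lt _ (by decide)⟩, ⟨n % 3, Nat.mod_lt _ (by decide)⟩)

/-- `c9 ∘ d9 = id` below `9`. [folklore] -/
private theorem c9_d9 {n : ℕ} (h : n < 9) : c9 (d9 n) = n := by
  simp only [c9, d9]; omega

/-- Decoding of a triple code. [folklore] -/
def tpt (q : ℕ) : Idx × Idx × Idx := (d9 (q / 81), d9 (q / 9 % 9), d9 (q % 9))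

/-- `tcode ∘ tpt = id` below `729`. [folklore] -/
private theorem tcode_tpt {q : ℕ} (h : q < 729) : tcode (tpt q) = q := by
  simp only [tcode, tpt]
  rw [c9_d9 (by omega), c9_d9 (Nat.mod_lt _ (by decide)), c9_d9 (Nat.mod_lt _ (by decide))]
  omega

/-! ## Soundness of the sparse-vector computations -/

/-- `coef` is additive under concatenation. [folklore] -/
private theorem coef_append (v w : List (ℕ × ℤ)) (c : ℕ) : coef (v ++ w) c = coef v c + coef w c := by
  induction v with
  | nil => simp [coef]
  | cons e v ih => simp only [List.cons_append, coef, ih]; ring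

/-- `coef` of a scaled vector. [folklore] -/
private theorem coef_scale (a : ℤ) (v : List (ℕ × ℤ)) (c : ℕ) : coef (scale a v) c = a * coef v c := by
  induction v with
  | nil => simp [coef, scale]
  | cons e v ih =>
    simp only [scale, List.map_cons, coef] at ih ⊢
    rw [ih]; split_ifs <;> ring

/-- A code outside the support has coefficient `0`. [folklore] -/
private theorem coef_eq_zero_of_forall {v : List (ℕ × ℤ)} {c : ℕ} (h : ∀ e ∈ v, e.1 ≠ c) :
    coef v c = 0 := by
  induction v with
  | nil => rfl
  | cons e v ih =>
    simp only [coef]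
    rw [if_neg (h e (by simp)), ih fun e' he' => h e' (by simp [he'])]
    simp

/-- A passed membership check: the residual vanishes identically. [folklore] -/
private theorem coef_residual {B : List (List (ℕ × ℤ))} {piv : List ℕ} {s : List (ℕ × ℤ)}
    (h : memCheck B piv s = true) (c : ℕ) : coef (residual B piv s) c = 0 := by
  unfold memCheck at h
  rw [List.all_eq_true] at h
  by_cases hc : ∃ e ∈ residual B piv s, e.1 = c
  · obtain ⟨e, he, rfl⟩ := hc
    simpa using h e he
  · push Not at hc
    exact coef_eq_zero_of_forall hc

/-- `coef` of the first-slot slice. [folklore] -/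
private theorem coef_sliceIList (x0 : ℕ) (w : List (ℕ × ℤ)) {c : ℕ} (hc : c < 81) :
    coef (sliceIList x0 w) c = coef w (81 * x0 + c) := by
  induction w with
  | nil => rfl
  | cons e w ih =>
    simp only [sliceIList]
    split_ifs with h1
    · simp only [coef, ih]
      by_cases h2 : e.1 % 81 = c
      · rw [if_pos h2, if_pos (by omega)]
      · rw [if_neg h2, if_neg (by omega)]
    · simp only [coef, ih]
      rw [if_neg (by omega)]; simp

/-- `coef` of the last-slot slice. [folklore] -/
private theorem coef_sliceKList (s1 : ℕ) (w : List (ℕ × ℤ)) (m : ℕ) (hs : s1 < 9) :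
    coef (sliceKList s1 w) m = coef w (9 * m + s1) := by
  induction w with
  | nil => rfl
  | cons e w ih =>
    simp only [sliceKList]
    split_ifs with h1
    · simp only [coef, ih]
      by_cases h2 : e.1 / 9 = m
      · rw [if_pos h2, if_pos (by omega)]
      · rw [if_neg h2, if_neg (by omega)]
    · simp only [coef, ih]
      rw [if_neg (by omega)]; simp

/-- `coef` of the middle slice. [folklore] -/
private theorem coef_sliceBList (b : ℕ) (w : List (ℕ × ℤ)) (m : ℕ) (hb : b < 9) :
    coef (sliceBList b w) m = coef w (81 * (m / 9) + 9 * b + m % 9) := by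
  induction w with
  | nil => rfl
  | cons e w ih =>
    simp only [sliceBList]
    split_ifs with h1
    · simp only [coef, ih]
      by_cases h2 : 9 * (e.1 / 81) + e.1 % 9 = m
      · rw [if_pos h2, if_pos (by omega)]
      · rw [if_neg h2, if_neg (by omega)]
    · simp only [coef, ih]
      rw [if_neg (by omega)]; simp

section Field

variable (K : Type u) [Field K]

/-- The pair function `(a, b) ↦ v(9a + b)` of a sparse vector, over `K`. [folklore] -/
def pfun (v : List (ℕ × ℤ)) : Idx × Idx → K := fun p => ((coef v (pcode p) : ℤ) : K)

/-- The triple function `(a, b, c) ↦ v(81a + 9b + c)` of a sparse vector, over `K`. [folklore] -/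
def tfun (v : List (ℕ × ℤ)) : Idx × Idx × Idx → K := fun p => ((coef v (tcode p) : ℤ) : K)

/-- The candidate subspace: the `K`-span of the first `17` rows of `B`. [folklore] -/
def Esp (B : List (List (ℕ × ℤ))) : Submodule K (Idx × Idx → K) :=
  Submodule.span K (Set.range fun i : Fin 17 => pfun K (B.getD i []))

/-- `dim Esp ≤ 17`. [folklore] -/
private theorem finrank_Esp_le (B : List (List (ℕ × ℤ))) : Module.finrank K (Esp K B) ≤ 17 := by
  have h := finrank_range_le_card (R := K) (fun i : Fin 17 => pfun K (B.getD i []))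
  rw [Fintype.card_fin] at h
  exact h

/-- `pfun [] = 0`. [folklore] -/
private theorem pfun_nil : pfun K [] = 0 := by
  funext p; simp [pfun, coef]

/-- `pfun` is additive under concatenation. [folklore] -/
private theorem pfun_append (v w : List (ℕ × ℤ)) : pfun K (v ++ w) = pfun K v + pfun K w := by
  funext p; simp [pfun, coef_append]

/-- `pfun` of a scaled vector. [folklore] -/
private theorem pfun_scale (a : ℤ) (v : List (ℕ × ℤ)) : pfun K (scale a v) = (a : K) • pfun K v := by
  funext p; simp [pfun, coef_scale]

/-- Linear combinations of rows lie in the span. [folklore] -/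
private theorem pfun_lin_mem (cs : ℕ → ℤ) (B : List (List (ℕ × ℤ))) :
    ∀ L : List ℕ, (∀ i ∈ L, i < 17) → pfun K (lin cs B L) ∈ Esp K B
  | [], _ => by rw [lin, pfun_nil]; exact zero_mem _
  | i :: L, hL => by
    rw [lin, pfun_append]
    refine add_mem ?_ (pfun_lin_mem cs B L fun j hj => hL j (List.mem_cons_of_mem _ hj))
    split_ifs with h0
    · rw [pfun_nil]; exact zero_mem _
    · rw [pfun_scale]
      exact Submodule.smul_mem _ _ (Submodule.subset_span ⟨⟨i, hL i (by simp)⟩, rfl⟩)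

/-- **Membership by certificate**: a passed `memCheck` puts `pfun s` in the span. [folklore] -/
private theorem pfun_mem_of_memCheck {B : List (List (ℕ × ℤ))} {piv : List ℕ} {s : List (ℕ × ℤ)}
    (h : memCheck B piv s = true) : pfun K s ∈ Esp K B := by
  have key : pfun K s = -pfun K (lin (fun i => -coef s (piv.getD i 0)) B (List.range 17)) := by
    funext p
    have hz := coef_residual h (pcode p)
    rw [residual, coef_append] at hz
    simp only [pfun, Pi.neg_apply]
    rw [← Int.cast_neg]
    congr 1; omega
  rw [key]
  exact neg_mem (pfun_lin_mem K _ B _ fun i hi => List.mem_range.1 hi)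

/-- Casts of `coef` at equal codes agree. [folklore] -/
private theorem cast_coef_congr (w : List (ℕ × ℤ)) {a b : ℕ} (h : a = b) :
    ((coef w a : ℤ) : K) = ((coef w b : ℤ) : K) := by rw [h]

/-- The first-slot slice of a triple function is the pair function of `sliceIList`. [folklore] -/
private theorem sliceI_tfun (x0 : Idx) (w : List (ℕ × ℤ)) :
    sliceI x0 (tfun K w) = pfun K (sliceIList (c9 x0) w) := by
  funext p
  have h1 := c9_lt p.1; have h2 := c9_lt p.2
  simp only [sliceI_apply, tfun, pfun, tcode, pcode]
  rw [coef_sliceIList _ _ (by omega)]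
  exact cast_coef_congr K w (by omega)

/-- The `ι`-slice of a triple function is the pair function of `sliceIList`. [folklore] -/
private theorem sliceA_tfun (a : Idx) (w : List (ℕ × ℤ)) :
    sliceA a (tfun K w) = pfun K (sliceIList (c9 a) w) := by
  funext p
  have h1 := c9_lt p.1; have h2 := c9_lt p.2
  simp only [sliceA_apply, tfun, pfun, tcode, pcode]
  rw [coef_sliceIList _ _ (by omega)]
  exact cast_coef_congr K w (by omega)

/-- The last-slot slice of a triple function is the pair function of `sliceKList`. [folklore] -/
private theorem sliceK_tfun (s1 : Idx) (w : List (ℕ × ℤ)) :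
    sliceK s1 (tfun K w) = pfun K (sliceKList (c9 s1) w) := by
  funext p
  have h0 := c9_lt s1
  simp only [sliceK_apply, tfun, pfun, tcode, pcode]
  rw [coef_sliceKList _ _ _ h0]
  exact cast_coef_congr K w (by omega)

/-- The `μ`-slice of a triple function is the pair function of `sliceKList`. [folklore] -/
private theorem sliceC_tfun (c : Idx) (w : List (ℕ × ℤ)) :
    sliceC c (tfun K w) = pfun K (sliceKList (c9 c) w) := by
  funext p
  have h0 := c9_lt c
  simp only [sliceC_apply, tfun, pfun, tcode, pcode]
  rw [coef_sliceKList _ _ _ h0]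
  exact cast_coef_congr K w (by omega)

/-- The `κ`-slice of a triple function is the pair function of `sliceBList`. [folklore] -/
private theorem sliceB_tfun (b : Idx) (w : List (ℕ × ℤ)) :
    sliceB b (tfun K w) = pfun K (sliceBList (c9 b) w) := by
  funext p
  have h0 := c9_lt b; have h1 := c9_lt p.1; have h2 := c9_lt p.2
  simp only [sliceB_apply, tfun, pfun, tcode, pcode]
  rw [coef_sliceBList _ _ _ h0]
  exact cast_coef_congr K w (by omega)

/-- Independent members bound the dimension from below. [folklore] -/
private theorem le_finrank_of_mem {V : Type*} [AddCommGroup V] [Module K V] [Module.Finite K V]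
    (T : Submodule K V) {n : ℕ} {f : Fin n → V} (hf : LinearIndependent K f)
    (hmem : ∀ j, f j ∈ T) : n ≤ Module.finrank K T :=
  calc n = Fintype.card (Fin n) := (Fintype.card_fin n).symm
    _ = Module.finrank K (Submodule.span K (Set.range f)) := (finrank_span_eq_card hf).symm
    _ ≤ Module.finrank K T :=
        Submodule.finrank_mono (Submodule.span_le.2 (Set.range_subset_iff.2 hmem))

/-- **Independence by pivots**: a passed `pivCheck` makes the `17` triple functions linearly
independent over any field. [folklore] -/
private theorem linearIndependent_of_pivCheck {W : List (List (ℕ × ℤ))} {qs : List ℕ}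
    (h : pivCheck W qs = true) : LinearIndependent K fun j : Fin 17 => tfun K (W.getD j []) := by
  have h' : ∀ j < 17, qs.getD j 0 < 729 ∧ coef (W.getD j []) (qs.getD j 0) = 1 ∧
      ∀ k < 17, j = k ∨ coef (W.getD k []) (qs.getD j 0) = 0 := by
    intro j hj
    have := List.all_eq_true.1 h j (List.mem_range.2 hj)
    simp only [Bool.and_eq_true, decide_eq_true_eq, beq_iff_eq, List.all_eq_true, List.mem_range,
      Bool.or_eq_true] at this
    exact ⟨this.1.1, this.1.2, this.2⟩
  refine linearIndependent_of_triangular _ (fun j => tpt (qs.getD j 0)) ?_ ?_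
  · intro j
    obtain ⟨hq, h1, -⟩ := h' j j.isLt
    simp only [tfun, tcode_tpt hq, h1, Int.cast_one]
    exact one_ne_zero
  · intro s t hts
    obtain ⟨hq, -, h0⟩ := h' t t.isLt
    have hlt := Fin.lt_def.1 hts
    rcases h0 s s.isLt with hst | hst
    · exact absurd hlt (by omega)
    · simp only [tfun, tcode_tpt hq, hst, Int.cast_zero]

/-- A passed symmetry check: the triple function lies in `S²A ⊗ B` (first two slots). [folklore] -/
private theorem tfun_mem_symA {w : List (ℕ × ℤ)}
    (h : ((List.range 729).all fun c => coef w c == coef w (swapI c)) = true) :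
    tfun K w ∈ symA K (α := Idx) (β := Idx) := by
  rw [mem_symA]
  intro a a' b
  have hc := List.all_eq_true.1 h (tcode (a, a', b)) (List.mem_range.2 (tcode_lt _))
  rw [beq_iff_eq] at hc
  have hs : swapI (tcode (a, a', b)) = tcode (a', a, b) := by
    have := c9_lt a; have := c9_lt a'; have := c9_lt b
    simp only [swapI, tcode]; omega
  show ((coef w (tcode (a, a', b)) : ℤ) : K) = ((coef w (tcode (a', a, b)) : ℤ) : K)
  rw [hc, hs]

/-- A passed symmetry check: the triple function lies in `A ⊗ S²B` (last two slots). [folklore] -/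
private theorem tfun_mem_symB {w : List (ℕ × ℤ)}
    (h : ((List.range 729).all fun c => coef w c == coef w (swapK c)) = true) :
    tfun K w ∈ symB K (α := Idx) (β := Idx) := by
  rw [mem_symB]
  intro a b b'
  have hc := List.all_eq_true.1 h (tcode (a, b, b')) (List.mem_range.2 (tcode_lt _))
  rw [beq_iff_eq] at hc
  have hs : swapK (tcode (a, b, b')) = tcode (a, b', b) := by
    have := c9_lt a; have := c9_lt b; have := c9_lt b'
    simp only [swapK, tcode]; omega
  show ((coef w (tcode (a, b, b')) : ℤ) : K) = ((coef w (tcode (a, b', b)) : ℤ) : K)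
  rw [hc, hs]

/-- **`(210)`-type test from a certificate**: `17 ≤ dim testI E`. [folklore] -/
private theorem le_finrank_testI {B : List (List (ℕ × ℤ))} {piv : List ℕ} {W : List (List (ℕ × ℤ))}
    {qs : List ℕ} (h : testICheck B piv W qs = true) :
    17 ≤ Module.finrank K (testI (Esp K B)) := by
  rw [testICheck, Bool.and_eq_true] at h
  obtain ⟨hp, hall⟩ := h
  refine le_finrank_of_mem K (testI (Esp K B)) (linearIndependent_of_pivCheck K hp) fun j => ?_
  have hj := List.all_eq_true.1 hall j (List.mem_range.2 j.isLt)
  rw [Bool.and_eq_true] at hj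
  obtain ⟨hsym, hsl⟩ := hj
  rw [testI, Submodule.mem_inf]
  refine ⟨tfun_mem_symA K hsym, mem_slicesI.2 fun x0 => ?_⟩
  rw [sliceI_tfun]
  exact pfun_mem_of_memCheck K (List.all_eq_true.1 hsl (c9 x0) (List.mem_range.2 (c9_lt x0)))

/-- **`(120)`-type test from a certificate**: `17 ≤ dim testK E`. [folklore] -/
private theorem le_finrank_testK {B : List (List (ℕ × ℤ))} {piv : List ℕ} {W : List (List (ℕ × ℤ))}
    {qs : List ℕ} (h : testKCheck B piv W qs = true) :
    17 ≤ Module.finrank K (testK (Esp K B)) := by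
  rw [testKCheck, Bool.and_eq_true] at h
  obtain ⟨hp, hall⟩ := h
  refine le_finrank_of_mem K (testK (Esp K B)) (linearIndependent_of_pivCheck K hp) fun j => ?_
  have hj := List.all_eq_true.1 hall j (List.mem_range.2 j.isLt)
  rw [Bool.and_eq_true] at hj
  obtain ⟨hsym, hsl⟩ := hj
  rw [testK, Submodule.mem_inf]
  refine ⟨tfun_mem_symB K hsym, mem_slicesK.2 fun s1 => ?_⟩
  rw [sliceK_tfun]
  exact pfun_mem_of_memCheck K (List.all_eq_true.1 hsl (c9 s1) (List.mem_range.2 (c9_lt s1)))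

/-- **`(111)` test from a certificate**: `17 ≤ dim ((E₁ ⊗ C) ∩ (A ⊗ E₂) ∩ (E₃ ⊗ B))`. [folklore] -/
private theorem le_finrank_tripleInter {B1 : List (List (ℕ × ℤ))} {piv1 : List ℕ}
    {B2 : List (List (ℕ × ℤ))} {piv2 : List ℕ} {B3 : List (List (ℕ × ℤ))} {piv3 : List ℕ}
    {W : List (List (ℕ × ℤ))} {qs : List ℕ}
    (h : tripleCheck B1 piv1 B2 piv2 B3 piv3 W qs = true) :
    17 ≤ Module.finrank K (tripleInter (Esp K B1) (Esp K B2) (Esp K B3)) := by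
  rw [tripleCheck, Bool.and_eq_true] at h
  obtain ⟨hp, hall⟩ := h
  refine le_finrank_of_mem K _ (linearIndependent_of_pivCheck K hp) fun j => ?_
  have hj := List.all_eq_true.1 hall j (List.mem_range.2 j.isLt)
  simp only [Bool.and_eq_true] at hj
  obtain ⟨⟨h1, h2⟩, h3⟩ := hj
  rw [mem_tripleInter]
  refine ⟨fun c => ?_, fun a => ?_, fun b => ?_⟩
  · rw [sliceC_tfun]
    exact pfun_mem_of_memCheck K (List.all_eq_true.1 h1 (c9 c) (List.mem_range.2 (c9_lt c)))
  · rw [sliceA_tfun]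
    exact pfun_mem_of_memCheck K (List.all_eq_true.1 h2 (c9 a) (List.mem_range.2 (c9_lt a)))
  · rw [sliceB_tfun]
    exact pfun_mem_of_memCheck K (List.all_eq_true.1 h3 (c9 b) (List.mem_range.2 (c9_lt b)))

/-- `M⟨3⟩` in codes. [folklore] -/
private theorem matMulTensor_three_apply (a b c : Idx) :
    matMulTensor K 3 3 3 a b c = ((tZ (c9 a) (c9 b) (c9 c) : ℤ) : K) := by
  simp only [matMulTensor, tZ, c9_div, c9_mod, Fin.ext_iff]
  split_ifs <;> simp

/-- A passed slice check puts a slice-shaped function in the span. [folklore] -/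
private theorem mem_of_sliceCheck {k : ℕ} {B : List (List (ℕ × ℤ))} {piv : List ℕ}
    (h : sliceCheck k B piv = true) (n : Idx) (g : Idx × Idx → K)
    (hg : ∀ p, g p = ((tZk k (c9 n) (pcode p) : ℤ) : K)) : g ∈ Esp K B := by
  have hn := List.all_eq_true.1 h (c9 n) (List.mem_range.2 (c9_lt n))
  rw [Bool.and_eq_true] at hn
  obtain ⟨hco, hmem⟩ := hn
  have hfun : g = pfun K (tslice k (c9 n)) := by
    funext p
    have hp := List.all_eq_true.1 hco (pcode p) (List.mem_range.2 (pcode_lt p))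
    rw [beq_iff_eq] at hp
    rw [hg, pfun, hp]
  rw [hfun]
  exact pfun_mem_of_memCheck K hmem

/-- The slices `t(·,·,c)` of `M⟨3⟩` lie in `E₁`. [folklore] -/
private theorem slice₁_mem {B : List (List (ℕ × ℤ))} {piv : List ℕ} (h : sliceCheck 1 B piv = true)
    (c : Idx) : (fun ab : Idx × Idx => matMulTensor K 3 3 3 ab.1 ab.2 c) ∈ Esp K B :=
  mem_of_sliceCheck K h c _ fun p => by
    rw [matMulTensor_three_apply]; simp [tZk, pcode_div, pcode_mod]

/-- The slices `t(a,·,·)` of `M⟨3⟩` lie in `E₂`. [folklore] -/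
private theorem slice₂_mem {B : List (List (ℕ × ℤ))} {piv : List ℕ} (h : sliceCheck 2 B piv = true)
    (a : Idx) : (fun bc : Idx × Idx => matMulTensor K 3 3 3 a bc.1 bc.2) ∈ Esp K B :=
  mem_of_sliceCheck K h a _ fun p => by
    rw [matMulTensor_three_apply]; simp [tZk, pcode_div, pcode_mod]

/-- The slices `t(·,b,·)` of `M⟨3⟩` lie in `E₃`. [folklore] -/
private theorem slice₃_mem {B : List (List (ℕ × ℤ))} {piv : List ℕ} (h : sliceCheck 3 B piv = true)
    (b : Idx) : (fun ac : Idx × Idx => matMulTensor K 3 3 3 ac.1 b ac.2) ∈ Esp K B :=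
  mem_of_sliceCheck K h b _ fun p => by
    rw [matMulTensor_three_apply]; simp [tZk, pcode_div, pcode_mod]

end Field

/-! ## Kernel runs -/

/-- The slices `t(·,·,c)` pass against `B1`. [folklore] -/
private theorem sliceCheck_one : sliceCheck 1 B1 B1piv = true := by decide +kernel

/-- The slices `t(a,·,·)` pass against `B2`. [folklore] -/
private theorem sliceCheck_two : sliceCheck 2 B2 B2piv = true := by decide +kernel

/-- The slices `t(·,b,·)` pass against `B3`. [folklore] -/
private theorem sliceCheck_three : sliceCheck 3 B3 B3piv = true := by decide +kernel

/-- The `(210)` test of `E₁` (dimension `18 ≥ 17`). [folklore] -/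
private theorem testICheck_one : testICheck B1 B1piv WI1 WI1piv = true := by decide +kernel

/-- The `(120)` test of `E₁` (dimension `20 ≥ 17`). [folklore] -/
private theorem testKCheck_one : testKCheck B1 B1piv WK1 WK1piv = true := by decide +kernel

/-- The `(021)` test of `E₂` (dimension `18 ≥ 17`). [folklore] -/
private theorem testICheck_two : testICheck B2 B2piv WI2 WI2piv = true := by decide +kernel

/-- The `(012)` test of `E₂` (dimension `18 ≥ 17`). [folklore] -/
private theorem testKCheck_two : testKCheck B2 B2piv WK2 WK2piv = true := by decide +kernel

/-- The `(201)` test of `E₃` (dimension `19 ≥ 17`). [folklore] -/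
private theorem testICheck_three : testICheck B3 B3piv WI3 WI3piv = true := by decide +kernel

/-- The `(102)` test of `E₃` (dimension `24 ≥ 17`). [folklore] -/
private theorem testKCheck_three : testKCheck B3 B3piv WK3 WK3piv = true := by decide +kernel

/-- The `(111)` test of `(E₁, E₂, E₃)` (dimension exactly `17`). [folklore] -/
private theorem tripleCheck_holds : tripleCheck B1 B1piv B2 B2piv B3 B3piv WT WTpiv = true := by
  decide +kernel

/-! ## The theorem -/

/-- **Border apolarity passes its degree-`≤ 3` tests at `r = 17` for `M⟨3⟩`, over every field**:
there are `E₁ ⊆ A ⊗ B`, `E₂ ⊆ B ⊗ C`, `E₃ ⊆ A ⊗ C` with `dim ≤ 17` containing the slices of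
`M⟨3⟩` and passing the six `(210)`-type tests and the `(111)` test with `r = 17`
(`IsCandidateTriple 17`). The span-side, tri-degree-`≤ 3` content of CHL's Remark 1.8 ("we went on
to find an ideal passing all border apolarity tests for `M⟨3⟩` with `r = 17`"); so the `(210)`,
`(120)`, `(111)` dimension tests behind `seventeen_le_algBorderRank_matMulTensor_three` are
satisfiable at `r = 17` and cannot by themselves give `18`.
[cite: ConnerHarperLandsberg2023, Rem. 1.8] -/
theorem exists_isCandidateTriple_seventeen (K : Type u) [Field K] :
    ∃ (E₁ E₂ E₃ : Submodule K (Idx × Idx → K)),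
      IsCandidateTriple 17 (matMulTensor K 3 3 3) E₁ E₂ E₃ :=
  ⟨Esp K B1, Esp K B2, Esp K B3,
   { finrank₁ := finrank_Esp_le K B1
     finrank₂ := finrank_Esp_le K B2
     finrank₃ := finrank_Esp_le K B3
     slice₁ := slice₁_mem K sliceCheck_one
     slice₂ := slice₂_mem K sliceCheck_two
     slice₃ := slice₃_mem K sliceCheck_three
     testI₁ := le_finrank_testI K testICheck_one
     testK₁ := le_finrank_testK K testKCheck_one
     testI₂ := le_finrank_testI K testICheck_two
     testK₂ := le_finrank_testK K testKCheck_two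
     testI₃ := le_finrank_testI K testICheck_three
     testK₃ := le_finrank_testK K testKCheck_three
     triple := le_finrank_tripleInter K tripleCheck_holds }⟩

end R17

/-! ## Admissibility at budget `r` (the Borel-fixed normal form of the `r = 16` refutation, any `r`) -/

section Admissible

variable {K : Type u} [Field K]

/-- **Admissible `(110)`-subspaces of `⟨3,3,3⟩` at budget `r`**: the closure properties of
`MatMul3.IsAdmissible` (`BorderRankMatMulThreeBlocks.lean`: root-coordinate and block-diagonal
components of elements lie in `E`, the nine block identities lie in `E`, stability under
`ad X_{pq}` and the block shifts for `p < q`) with `dim E ≤ r` in place of `dim E ≤ 16` — the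
intrinsic form of "torus graded, Borel fixed, contains the slices" used by the classification.
[cite: ConnerHarperLandsberg2023, §2.5 and §6] -/
structure IsAdmissibleAt (r : ℕ) (E : Submodule K (I9' × I9' → K)) : Prop where
  /-- root-coordinate components of elements lie in `E` -/
  unit_mem : ∀ j k i i', i ≠ i' → ∀ x ∈ E, (Pi.single (blk j k i i') (x (blk j k i i')) : _ → K) ∈ E
  /-- block-diagonal components of elements lie in `E` -/
  diag_mem : ∀ j k, ∀ x ∈ E, diagProj j k x ∈ E
  /-- the identity matrix of every block (a slice of `⟨3,3,3⟩`) lies in `E` -/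
  id_mem : ∀ j k, diagVec j k (fun _ => (1 : K)) ∈ E
  /-- stability under `ad X_{pq}`, `p < q` -/
  adU_mem : ∀ p q, p < q → ∀ x ∈ E, adU p q x ∈ E
  /-- stability under the block-row shifts -/
  shiftV_mem : ∀ p q, p < q → ∀ x ∈ E, shiftV p q x ∈ E
  /-- stability under the block-column shifts -/
  shiftW_mem : ∀ p q, p < q → ∀ x ∈ E, shiftW p q x ∈ E
  /-- `dim E ≤ r` -/
  finrank_le : Module.finrank K E ≤ r

/-- At budget `16` this is exactly `MatMul3.IsAdmissible`. [cite: ConnerHarperLandsberg2023, §6] -/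
theorem isAdmissibleAt_sixteen_iff (E : Submodule K (I9' × I9' → K)) :
    IsAdmissibleAt 16 E ↔ IsAdmissible E :=
  ⟨fun h => ⟨h.unit_mem, h.diag_mem, h.id_mem, h.adU_mem, h.shiftV_mem, h.shiftW_mem, h.finrank_le⟩,
    fun h => ⟨h.unit_mem, h.diag_mem, h.id_mem, h.adU_mem, h.shiftV_mem, h.shiftW_mem, h.finrank_le⟩⟩

/-- Admissibility is monotone in the budget. [cite: ConnerHarperLandsberg2023, §6] -/
theorem IsAdmissibleAt.mono {r s : ℕ} (hrs : r ≤ s) {E : Submodule K (I9' × I9' → K)}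
    (h : IsAdmissibleAt r E) : IsAdmissibleAt s E :=
  ⟨h.unit_mem, h.diag_mem, h.id_mem, h.adU_mem, h.shiftV_mem, h.shiftW_mem, h.finrank_le.trans hrs⟩

end Admissible

namespace R17

/-- The `(110)`-coordinates model `E₂ ∘ σ₂` (relabeled rows of `B2`, same order). [folklore] -/
def B2s : List (List (ℕ × ℤ)) := [
  [(20, 1), (50, 1), (80, 1)], [(19, 1), (49, 1), (79, 1)], [(18, 1), (48, 1), (78, 1)], [(11, 1), (41, 1), (71, 1)],
  [(10, 1), (40, 1), (70, 1)], [(9, 1), (39, 1), (69, 1)], [(12, 1)], [(16, 1)],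
  [(15, 1)], [(2, 1), (32, 1), (62, 1)], [(1, 1), (31, 1), (61, 1)], [(0, 1), (30, 1), (60, 1)],
  [(3, 1)], [(7, 1)], [(6, 1)], [(34, 1)],
  [(33, 1)]]

/-- Pivot codes of `B2s`. [folklore] -/
def B2spiv : List ℕ := [20, 19, 18, 11, 10, 9, 12, 16, 15, 2, 1, 0, 3, 7, 6, 34, 33]

/-- The `(110)`-coordinates model `E₃ ∘ σ₃` (relabeled rows of `B3`, same order). [folklore] -/
def B3s : List (List (ℕ × ℤ)) := [
  [(2, 1), (32, 1), (62, 1)], [(1, 1), (31, 1), (61, 1)], [(7, 1)], [(0, 1)],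
  [(3, 1)], [(6, 1)], [(34, 1)], [(27, 1)],
  [(30, 1)], [(33, 1)], [(60, 1)], [(11, 1), (41, 1), (71, 1)],
  [(10, 1), (40, 1), (70, 1)], [(9, 1), (39, 1), (69, 1)], [(20, 1), (50, 1), (80, 1)], [(19, 1), (49, 1), (79, 1)],
  [(18, 1), (48, 1), (78, 1)]]

/-- Pivot codes of `B3s`. [folklore] -/
def B3spiv : List ℕ := [2, 1, 7, 0, 3, 6, 34, 27, 30, 33, 60, 11, 10, 9, 20, 19, 18]

/-! ## Block coordinates on codes and the Borel operators on sparse vectors (computation) -/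

/-- The sparse vector `c ↦ f c` on the `81` pair codes (zero values dropped). [folklore] -/
def denseMap (f : ℕ → ℤ) : List (ℕ × ℤ) :=
  ((List.range 81).map fun c => (c, f c)).filter fun e => e.2 != 0

/-- Matrix row `i` of the pair code `9(3i+k) + (3i'+j)`. [folklore] -/
def bI (c : ℕ) : ℕ := c / 9 / 3

/-- Block column `k` of a pair code. [folklore] -/
def bK (c : ℕ) : ℕ := c / 9 % 3

/-- Matrix column `i'` of a pair code. [folklore] -/
def bI' (c : ℕ) : ℕ := c % 9 / 3

/-- Block row `j` of a pair code. [folklore] -/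
def bJ (c : ℕ) : ℕ := c % 9 % 3

/-- The pair code of block `(j,k)`, position `(i,i')`. [folklore] -/
def bcode (j k i i' : ℕ) : ℕ := 9 * (3 * i + k) + (3 * i' + j)

/-- `ad X_{pq}` on sparse vectors (`MatMul3.adU_blk`). [folklore] -/
def adUList (p q : ℕ) (v : List (ℕ × ℤ)) : List (ℕ × ℤ) :=
  denseMap fun c =>
    (if bI c = p then coef v (bcode (bJ c) (bK c) q (bI' c)) else 0) -
      (if bI' c = q then coef v (bcode (bJ c) (bK c) (bI c) p) else 0)

/-- The block-row shift on sparse vectors (`MatMul3.shiftV_blk`). [folklore] -/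
def shiftVList (p q : ℕ) (v : List (ℕ × ℤ)) : List (ℕ × ℤ) :=
  denseMap fun c => if bJ c = p then coef v (bcode q (bK c) (bI c) (bI' c)) else 0

/-- The block-column shift on sparse vectors (`MatMul3.shiftW_blk`). [folklore] -/
def shiftWList (p q : ℕ) (v : List (ℕ × ℤ)) : List (ℕ × ℤ) :=
  denseMap fun c => if bK c = p then coef v (bcode (bJ c) q (bI c) (bI' c)) else 0

/-- The block-diagonal projection on sparse vectors (`MatMul3.diagProj`). [folklore] -/
def diagList (j k : ℕ) (v : List (ℕ × ℤ)) : List (ℕ × ℤ) :=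
  denseMap fun c => if bK c = k ∧ bJ c = j ∧ bI c = bI' c then coef v c else 0

/-- The coordinate component at block `(j,k)`, position `(i,i')`, on sparse vectors. [folklore] -/
def unitList (j k i i' : ℕ) (v : List (ℕ × ℤ)) : List (ℕ × ℤ) :=
  denseMap fun c => if bJ c = j ∧ bK c = k ∧ bI c = i ∧ bI' c = i' then coef v c else 0

/-- The identity matrix of block `(j,k)` as a sparse vector. [folklore] -/
def idList (j k : ℕ) : List (ℕ × ℤ) :=
  denseMap fun c => if bK c = k ∧ bJ c = j ∧ bI c = bI' c then 1 else 0

/-- The admissibility check of a model `(B, piv)` at budget `17`: images of the `17` rows under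
the coordinate components, block-diagonal projections, `ad X_{pq}` and the shifts (`p < q`) lie in
the span, and so do the nine block identities. [folklore] -/
def admCheck (B : List (List (ℕ × ℤ))) (piv : List ℕ) : Bool :=
  ((List.range 3).all fun j => (List.range 3).all fun k => memCheck B piv (idList j k)) &&
  (List.range 17).all fun n =>
    let v := B.getD n []
    ((List.range 3).all fun j => (List.range 3).all fun k =>
      memCheck B piv (diagList j k v) &&
        (List.range 3).all fun i => (List.range 3).all fun i' =>
          (i == i') || (coef v (bcode j k i i') == 0) || memCheck B piv (unitList j k i i' v)) &&
    ((List.range 3).all fun p => (List.range 3).all fun q =>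
      !(decide (p < q)) || (memCheck B piv (adUList p q v) && memCheck B piv (shiftVList p q v) &&
        memCheck B piv (shiftWList p q v)))

/-- `σ₂` on pair codes: `((i,k),(i',j)) ↦ ((2-k, i), (i', 2-j))`. [folklore] -/
def sig2c (c : ℕ) : ℕ := 9 * (3 * (2 - bK c) + bI c) + (3 * bI' c + (2 - bJ c))

/-- `σ₃` on pair codes: `((i,k),(i',j)) ↦ ((k, i), (2-j, i'))`. [folklore] -/
def sig3c (c : ℕ) : ℕ := 9 * (3 * bK c + bI c) + (3 * (2 - bJ c) + bI' c)

/-- Relabeling check: row `n` of `Bs` is row `n` of `B` composed with the code map `σc`. [folklore] -/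
def relabelCheck (σc : ℕ → ℕ) (B Bs : List (List (ℕ × ℤ))) : Bool :=
  (List.range 17).all fun n => (List.range 81).all fun c =>
    coef (Bs.getD n []) c == coef (B.getD n []) (σc c)

/-! ## Soundness of the Borel operators -/

/-- `coef` of a graph list over distinct codes. [folklore] -/
private theorem coef_map_pair (f : ℕ → ℤ) (L : List ℕ) (hL : L.Nodup) (c : ℕ) :
    coef (L.map fun c => (c, f c)) c = if c ∈ L then f c else 0 := by
  induction L with
  | nil => simp [coef]
  | cons a L ih =>
    rw [List.nodup_cons] at hL
    simp only [List.map_cons, coef, ih hL.2, List.mem_cons]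
    by_cases h : a = c
    · subst h
      simp [hL.1]
    · have h' : ¬c = a := fun e => h e.symm
      simp [h, h']

/-- Dropping zero-valued entries does not change `coef`. [folklore] -/
private theorem coef_filter_ne (l : List (ℕ × ℤ)) (c : ℕ) :
    coef (l.filter fun e => e.2 != 0) c = coef l c := by
  induction l with
  | nil => rfl
  | cons e l ih =>
    rw [List.filter_cons]
    by_cases h : e.2 = 0
    · simp [h, coef, ih]
    · simp [h, coef, ih]

/-- `coef (denseMap f) c = f c` below `81`. [folklore] -/
private theorem coef_denseMap (f : ℕ → ℤ) {c : ℕ} (hc : c < 81) : coef (denseMap f) c = f c := by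
  rw [denseMap, coef_filter_ne, coef_map_pair f _ (List.nodup_range) c, if_pos (List.mem_range.2 hc)]

/-- `bcode < 81`. [folklore] -/
private theorem bcode_lt (j k i i' : Fin 3) : bcode j k i i' < 81 := by
  have := j.isLt; have := k.isLt; have := i.isLt; have := i'.isLt; unfold bcode; omega

/-- The pair code of a block coordinate. [folklore] -/
private theorem pcode_blk (j k i i' : Fin 3) : pcode (blk j k i i') = bcode j k i i' := rfl

/-- Decoding the matrix row. [folklore] -/
private theorem bI_bcode (j k i i' : Fin 3) : bI (bcode j k i i') = i := by
  have := j.isLt; have := k.isLt; have := i'.isLt; unfold bI bcode; omega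

/-- Decoding the block column. [folklore] -/
private theorem bK_bcode (j k i i' : Fin 3) : bK (bcode j k i i') = k := by
  have := j.isLt; have := k.isLt; have := i'.isLt; unfold bK bcode; omega

/-- Decoding the matrix column. [folklore] -/
private theorem bI'_bcode (j k i i' : Fin 3) : bI' (bcode j k i i') = i' := by
  have := j.isLt; have := k.isLt; have := i'.isLt; unfold bI' bcode; omega

/-- Decoding the block row. [folklore] -/
private theorem bJ_bcode (j k i i' : Fin 3) : bJ (bcode j k i i') = j := by
  have := j.isLt; have := k.isLt; have := i'.isLt; unfold bJ bcode; omega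

section FieldB

variable (K : Type u) [Field K]

/-- Values of `pfun` at block coordinates. [folklore] -/
private theorem pfun_blk (v : List (ℕ × ℤ)) (j k i i' : Fin 3) :
    pfun K v (blk j k i i') = ((coef v (bcode j k i i') : ℤ) : K) := rfl

/-- Values of `pfun (denseMap f)` at block coordinates. [folklore] -/
private theorem pfun_denseMap_blk (f : ℕ → ℤ) (j k i i' : Fin 3) :
    pfun K (denseMap f) (blk j k i i') = ((f (bcode j k i i') : ℤ) : K) := by
  rw [pfun_blk, coef_denseMap f (bcode_lt j k i i')]

/-- `ad X_{pq}` on `pfun`. [folklore] -/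
private theorem adU_pfun (p q : Fin 3) (v : List (ℕ × ℤ)) :
    adU p q (pfun K v) = pfun K (adUList p q v) := by
  funext c
  rw [← blk_eta c, adU_blk, adUList, pfun_denseMap_blk, pfun_blk, pfun_blk]
  simp only [bI_bcode, bK_bcode, bI'_bcode, bJ_bcode, Int.cast_sub, Int.cast_ite, Int.cast_zero,
    Fin.ext_iff]

/-- The block-row shift on `pfun`. [folklore] -/
private theorem shiftV_pfun (p q : Fin 3) (v : List (ℕ × ℤ)) :
    shiftV p q (pfun K v) = pfun K (shiftVList p q v) := by
  funext c
  rw [← blk_eta c, shiftV_blk, shiftVList, pfun_denseMap_blk, pfun_blk]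
  simp only [bI_bcode, bK_bcode, bI'_bcode, bJ_bcode, Int.cast_ite, Int.cast_zero, Fin.ext_iff]

/-- The block-column shift on `pfun`. [folklore] -/
private theorem shiftW_pfun (p q : Fin 3) (v : List (ℕ × ℤ)) :
    shiftW p q (pfun K v) = pfun K (shiftWList p q v) := by
  funext c
  rw [← blk_eta c, shiftW_blk, shiftWList, pfun_denseMap_blk, pfun_blk]
  simp only [bI_bcode, bK_bcode, bI'_bcode, bJ_bcode, Int.cast_ite, Int.cast_zero, Fin.ext_iff]

/-- The block-diagonal projection on `pfun`. [folklore] -/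
private theorem diagProj_pfun (j k : Fin 3) (v : List (ℕ × ℤ)) :
    diagProj j k (pfun K v) = pfun K (diagList j k v) := by
  funext c
  rw [← blk_eta c, diagProj_eq_diagVec, diagVec_blk, diagList, pfun_denseMap_blk, pfun_blk]
  simp only [bI_bcode, bK_bcode, bI'_bcode, bJ_bcode, Int.cast_ite, Int.cast_zero, Fin.ext_iff]
  by_cases h : (c.1.2 : ℕ) = k ∧ (c.2.2 : ℕ) = j ∧ (c.1.1 : ℕ) = c.2.1
  · rw [if_pos h, if_pos h]
    obtain ⟨h1, h2, h3⟩ := h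
    rw [h1, h2, ← h3]
  · rw [if_neg h, if_neg h]

/-- The coordinate component on `pfun`. [folklore] -/
private theorem single_pfun (j k i i' : Fin 3) (v : List (ℕ × ℤ)) :
    (Pi.single (blk j k i i') (pfun K v (blk j k i i')) : I9' × I9' → K) =
      pfun K (unitList j k i i' v) := by
  funext c
  rw [← blk_eta c, single_blk, unitList, pfun_denseMap_blk, pfun_blk]
  simp only [bI_bcode, bK_bcode, bI'_bcode, bJ_bcode, Int.cast_ite, Int.cast_zero, Fin.ext_iff]
  by_cases h : (c.2.2 : ℕ) = j ∧ (c.1.2 : ℕ) = k ∧ (c.1.1 : ℕ) = i ∧ (c.2.1 : ℕ) = i'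
  · rw [if_pos h, if_pos h]
    obtain ⟨h1, h2, h3, h4⟩ := h
    rw [Fin.ext h1, Fin.ext h2, Fin.ext h3, Fin.ext h4]
  · rw [if_neg h, if_neg h]

/-- The block identity as `pfun`. [folklore] -/
private theorem diagVec_one_eq_pfun (j k : Fin 3) :
    diagVec j k (fun _ => (1 : K)) = pfun K (idList j k) := by
  funext c
  rw [← blk_eta c, diagVec_blk, idList, pfun_denseMap_blk]
  simp only [bI_bcode, bK_bcode, bI'_bcode, bJ_bcode, Int.cast_ite, Int.cast_zero, Int.cast_one,
    Fin.ext_iff]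

/-- Stability of the span under a linear map, from its values on the rows. [folklore] -/
private theorem map_mem_Esp {B : List (List (ℕ × ℤ))}
    (L : (I9' × I9' → K) →ₗ[K] (I9' × I9' → K))
    (hgen : ∀ n : Fin 17, L (pfun K (B.getD n [])) ∈ Esp K B) :
    ∀ x ∈ Esp K B, L x ∈ Esp K B := by
  have hle : (Esp K B).map L ≤ Esp K B := by
    rw [Esp, Submodule.map_span_le]
    rintro _ ⟨n, rfl⟩
    exact hgen n
  intro x hx
  exact hle (Submodule.mem_map_of_mem hx)

/-- The coordinate component as a linear map. [folklore] -/
private def unitLM (c₀ : I9' × I9') : (I9' × I9' → K) →ₗ[K] (I9' × I9' → K) where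
  toFun x := Pi.single c₀ (x c₀)
  map_add' x y := by
    funext c
    simp only [Pi.add_apply, Pi.single_apply]
    split_ifs <;> simp
  map_smul' r x := by
    funext c
    simp only [Pi.smul_apply, smul_eq_mul, RingHom.id_apply, Pi.single_apply]
    split_ifs <;> simp

/-- **Admissibility from the certificate.** [folklore] -/
private theorem isAdmissibleAt_of_admCheck {B : List (List (ℕ × ℤ))} {piv : List ℕ}
    (h : admCheck B piv = true) : IsAdmissibleAt 17 (Esp K B) := by
  rw [admCheck, Bool.and_eq_true] at h
  obtain ⟨hid, hrows⟩ := h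
  have hrow : ∀ n < 17,
      (∀ j < 3, ∀ k < 3, memCheck B piv (diagList j k (B.getD n [])) = true ∧
        ∀ i < 3, ∀ i' < 3, (i = i' ∨ coef (B.getD n []) (bcode j k i i') = 0) ∨
          memCheck B piv (unitList j k i i' (B.getD n [])) = true) ∧
      (∀ p < 3, ∀ q < 3, p < q → memCheck B piv (adUList p q (B.getD n [])) = true ∧
        memCheck B piv (shiftVList p q (B.getD n [])) = true ∧
        memCheck B piv (shiftWList p q (B.getD n [])) = true) := by
    intro n hn
    have := List.all_eq_true.1 hrows n (List.mem_range.2 hn)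
    simp only [Bool.and_eq_true, List.all_eq_true, List.mem_range, Bool.or_eq_true, beq_iff_eq,
      Bool.not_eq_true', decide_eq_false_iff_not, not_lt] at this
    refine ⟨fun j hj k hk => ⟨(this.1 j hj k hk).1, fun i hi i' hi' => (this.1 j hj k hk).2 i hi i' hi'⟩,
      fun p hp q hq hpq => ?_⟩
    rcases this.2 p hp q hq with hle | hh
    · omega
    · exact ⟨hh.1.1, hh.1.2, hh.2⟩
  refine ⟨?_, ?_, ?_, ?_, ?_, ?_, finrank_Esp_le K B⟩
  · intro j k i i' hii' x hx
    refine map_mem_Esp K (unitLM K (blk j k i i')) (fun n => ?_) x hx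
    show (Pi.single (blk j k i i') (pfun K (B.getD n []) (blk j k i i')) : I9' × I9' → K) ∈ Esp K B
    rcases ((hrow n n.isLt).1 j j.isLt k k.isLt).2 i i.isLt i' i'.isLt with (he | he) | he
    · exact absurd (Fin.ext he) hii'
    · rw [pfun_blk, he, Int.cast_zero, Pi.single_zero]
      exact zero_mem _
    · rw [single_pfun]
      exact pfun_mem_of_memCheck K he
  · intro j k x hx
    refine map_mem_Esp K (diagProj j k) (fun n => ?_) x hx
    rw [diagProj_pfun]
    exact pfun_mem_of_memCheck K ((hrow n n.isLt).1 j j.isLt k k.isLt).1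
  · intro j k
    rw [diagVec_one_eq_pfun]
    have := List.all_eq_true.1 (List.all_eq_true.1 hid j (List.mem_range.2 j.isLt)) k
      (List.mem_range.2 k.isLt)
    exact pfun_mem_of_memCheck K this
  · intro p q hpq x hx
    refine map_mem_Esp K (adU p q) (fun n => ?_) x hx
    rw [adU_pfun]
    exact pfun_mem_of_memCheck K ((hrow n n.isLt).2 p p.isLt q q.isLt (Fin.lt_def.1 hpq)).1
  · intro p q hpq x hx
    refine map_mem_Esp K (shiftV p q) (fun n => ?_) x hx
    rw [shiftV_pfun]
    exact pfun_mem_of_memCheck K ((hrow n n.isLt).2 p p.isLt q q.isLt (Fin.lt_def.1 hpq)).2.1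
  · intro p q hpq x hx
    refine map_mem_Esp K (shiftW p q) (fun n => ?_) x hx
    rw [shiftW_pfun]
    exact pfun_mem_of_memCheck K ((hrow n n.isLt).2 p p.isLt q q.isLt (Fin.lt_def.1 hpq)).2.2

/-- `σ₂` on codes agrees with `MatMul3.σ₂`. [folklore] -/
private theorem pcode_σ₂ (j k i i' : Fin 3) : pcode (σ₂ (blk j k i i')) = sig2c (bcode j k i i') := by
  have hj := j.isLt; have hk := k.isLt; have hi := i.isLt; have hi' := i'.isLt
  simp only [σ₂, f₂, g₂, blk, Prod.map, pcode, c9, sig2c, bI_bcode, bK_bcode, bI'_bcode, bJ_bcode,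
    Fin.val_rev]
  omega

/-- `σ₃` on codes agrees with `MatMul3.σ₃`. [folklore] -/
private theorem pcode_σ₃ (j k i i' : Fin 3) : pcode (σ₃ (blk j k i i')) = sig3c (bcode j k i i') := by
  have hj := j.isLt; have hk := k.isLt; have hi := i.isLt; have hi' := i'.isLt
  simp only [σ₃, f₃, g₃, blk, Prod.map, pcode, c9, sig3c, bI_bcode, bK_bcode, bI'_bcode, bJ_bcode,
    Fin.val_rev]
  omega

/-- A passed relabeling check identifies the relabeled span. [folklore] -/
private theorem map_funLeft_Esp {σ : I9' × I9' → I9' × I9'} {σc : ℕ → ℕ}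
    (hσ : ∀ j k i i', pcode (σ (blk j k i i')) = σc (bcode j k i i'))
    {B Bs : List (List (ℕ × ℤ))} (h : relabelCheck σc B Bs = true) :
    (Esp K B).map (LinearMap.funLeft K K σ) = Esp K Bs := by
  have hrow : ∀ n : Fin 17, LinearMap.funLeft K K σ (pfun K (B.getD n [])) = pfun K (Bs.getD n []) := by
    intro n
    funext c
    rw [LinearMap.funLeft_apply, ← blk_eta c, pfun_blk]
    unfold pfun
    rw [hσ]
    have hc := List.all_eq_true.1 (List.all_eq_true.1 h n (List.mem_range.2 n.isLt))
      (bcode c.2.2 c.1.2 c.1.1 c.2.1) (List.mem_range.2 (bcode_lt _ _ _ _))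
    rw [beq_iff_eq] at hc
    rw [hc]
  rw [Esp, Esp, Submodule.map_span, ← Set.range_comp]
  congr 1
  ext x
  constructor
  · rintro ⟨n, rfl⟩; exact ⟨n, (hrow n).symm⟩
  · rintro ⟨n, rfl⟩; exact ⟨n, hrow n⟩

/-! ## Kernel runs for admissibility -/

/-- `E₁` is admissible at budget `17`. [folklore] -/
private theorem admCheck_one : admCheck B1 B1piv = true := by decide +kernel

/-- `E₂ ∘ σ₂` is admissible at budget `17`. [folklore] -/
private theorem admCheck_two : admCheck B2s B2spiv = true := by decide +kernel

/-- `E₃ ∘ σ₃` is admissible at budget `17`. [folklore] -/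
private theorem admCheck_three : admCheck B3s B3spiv = true := by decide +kernel

/-- `B2s` is `B2` relabeled by `σ₂`. [folklore] -/
private theorem relabelCheck_two : relabelCheck sig2c B2 B2s = true := by decide +kernel

/-- `B3s` is `B3` relabeled by `σ₃`. [folklore] -/
private theorem relabelCheck_three : relabelCheck sig3c B3 B3s = true := by decide +kernel

/-- **The `r = 17` witness is an ADMISSIBLE candidate triple** (the Borel-fixed normal form used
by the `r = 16` refutation, `exists_admissible_triple` of `BorderRankMatMulThreeTransport.lean`,
with budget `17`): over every field there are `E₁, E₂, E₃` with
`IsCandidateTriple 17 (matMulTensor K 3 3 3) E₁ E₂ E₃`, `E₁` admissible at budget `17`, and the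
`(110)`-relabelings `E₂ ∘ σ₂`, `E₃ ∘ σ₃` admissible at budget `17`. So the Borel-fixed enumeration
behind `seventeen_le_algBorderRank_matMulTensor_three`, rerun with `17` in place of `16`, does not
come back empty — the span-side, degree-`≤ 3` content of CHL's Remark 1.8.
[cite: ConnerHarperLandsberg2023, Rem. 1.8 and §6] -/
theorem exists_admissibleAt_candidateTriple_seventeen (K : Type u) [Field K] :
    ∃ (E₁ E₂ E₃ : Submodule K (I9' × I9' → K)),
      IsCandidateTriple 17 (matMulTensor K 3 3 3) E₁ E₂ E₃ ∧ IsAdmissibleAt 17 E₁ ∧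
        IsAdmissibleAt 17 (E₂.map (LinearMap.funLeft K K σ₂)) ∧
        IsAdmissibleAt 17 (E₃.map (LinearMap.funLeft K K σ₃)) := by
  refine ⟨Esp K B1, Esp K B2, Esp K B3, ?_, isAdmissibleAt_of_admCheck K admCheck_one, ?_, ?_⟩
  · exact
     { finrank₁ := finrank_Esp_le K B1
       finrank₂ := finrank_Esp_le K B2
       finrank₃ := finrank_Esp_le K B3
       slice₁ := slice₁_mem K sliceCheck_one
       slice₂ := slice₂_mem K sliceCheck_two
       slice₃ := slice₃_mem K sliceCheck_three
       testI₁ := le_finrank_testI K testICheck_one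
       testK₁ := le_finrank_testK K testKCheck_one
       testI₂ := le_finrank_testI K testICheck_two
       testK₂ := le_finrank_testK K testKCheck_two
       testI₃ := le_finrank_testI K testICheck_three
       testK₃ := le_finrank_testK K testKCheck_three
       triple := le_finrank_tripleInter K tripleCheck_holds }
  · rw [map_funLeft_Esp K pcode_σ₂ relabelCheck_two]
    exact isAdmissibleAt_of_admCheck K admCheck_two
  · rw [map_funLeft_Esp K pcode_σ₃ relabelCheck_three]
    exact isAdmissibleAt_of_admCheck K admCheck_three

end FieldB

end R17

end MatMul3

end BorderApolarity

/-- **Conner–Harper–Landsberg 2023, Remark 1.8 (its degree-`≤ 3` part), for every field `K`**: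
the elementary border-apolarity candidate conditions at `r = 17` are satisfiable for the `3 × 3`
matrix multiplication tensor — `∃ E₁ E₂ E₃, IsCandidateTriple 17 (matMulTensor K 3 3 3) E₁ E₂ E₃`.
Every approximate decomposition with `r` triads yields such a triple
(`BorderApolarity.exists_candidateTriple_of_isApproxDecomposition`); refuting them certifies `17`
for `M⟨3⟩` (with the Borel-fixed reduction: `seventeen_le_algBorderRank_matMulTensor_three`), and
by this theorem the same tests cannot certify `18`. [cite: ConnerHarperLandsberg2023, Rem. 1.8] -/
theorem exists_isCandidateTriple_seventeen_matMulTensor_three (K : Type) [Field K] :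
    ∃ (E₁ E₂ E₃ : Submodule K ((Fin 3 × Fin 3) × (Fin 3 × Fin 3) → K)),
      BorderApolarity.IsCandidateTriple 17 (matMulTensor K 3 3 3) E₁ E₂ E₃ :=
  BorderApolarity.MatMul3.R17.exists_isCandidateTriple_seventeen K

/-- **The admissible (Borel-fixed normal form) version, for every field `K`**: candidate spaces
`E₁, E₂, E₃` for `M⟨3⟩` at `r = 17` passing all degree-`≤ 3` tests, with `E₁`, `E₂ ∘ σ₂`, `E₃ ∘ σ₃`
admissible at budget `17` (`BorderApolarity.MatMul3.IsAdmissibleAt`) — the output shape of the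
Borel-fixed reduction `BorderApolarity.MatMul3.exists_admissible_triple` of the `r = 16` refutation,
one budget higher: CHL's enumeration rerun at `r = 17` has survivors passing `(111)` (Rem. 1.8).
[cite: ConnerHarperLandsberg2023, Rem. 1.8 and §6] -/
theorem exists_admissibleAt_candidateTriple_seventeen_matMulTensor_three (K : Type) [Field K] :
    ∃ (E₁ E₂ E₃ : Submodule K ((Fin 3 × Fin 3) × (Fin 3 × Fin 3) → K)),
      BorderApolarity.IsCandidateTriple 17 (matMulTensor K 3 3 3) E₁ E₂ E₃ ∧
        BorderApolarity.MatMul3.IsAdmissibleAt 17 E₁ ∧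
        BorderApolarity.MatMul3.IsAdmissibleAt 17
          (E₂.map (LinearMap.funLeft K K BorderApolarity.MatMul3.σ₂)) ∧
        BorderApolarity.MatMul3.IsAdmissibleAt 17
          (E₃.map (LinearMap.funLeft K K BorderApolarity.MatMul3.σ₃)) :=
  BorderApolarity.MatMul3.R17.exists_admissibleAt_candidateTriple_seventeen K

end Literature.Computability.AlgebraicComplexity
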